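import Literature.Probability.RandomPlanarGeometry.HexSAWBrickWallStripFugacityTwoSided
import Literature.Probability.RandomPlanarGeometry.HexSAWBrickWallPolygonGlue
import Literature.Probability.RandomPlanarGeometry.SAWPatternTheorem
import HarnessLib

/-!
# Two attractive walls at width one: switch walks and the explicit lower bound `μ_1(y,y) ≥ (m·y^m)^{1/(2m+1)}` (`y ≥ 1`, `m ≥ 1`)

Topic `Literature/Probability/RandomPlanarGeometry` (lane «pcv-sawmu»; continues `HexSAWBrickWallStripFugacityTwoSided.lean` —
`HexBW.stripZ₂ T n y z = C_{T,n}(y,z)` over the translation classes `HexBW.stripPairs T n` of the brick-wall strip `S_T = ℤ × {0,…,T}`,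
bottom weight on row `0` / odd abscissa (`HexBW.bottomVisits₀`), top weight on row `T` / `x + T` even (`HexBW.topVisits₀`), the Fekete
rate `HexBW.stripMuY₂ T y z = μ_T(y,z)` and `HexBW.tendsto_stripZ₂_rpow : C_{T,n}(y,z)^{1/n} → μ_T(y,z)`).

Source frame: N. R. Beaton, M. Bousquet-Mélou, J. de Gier, H. Duminil-Copin, A. J. Guttmann, *The critical fugacity for surface
adsorption of self-avoiding walks on the honeycomb lattice is `1 + √2`*, CMP 326 (2014) = arXiv:1109.0358v5, §3.2 (p. 10:
`C_{T,k}(y,z) = Σ_{|ω|=k} y^{bc(ω)} z^{tc(ω)}`, Proposition 6: `μ_T(y,z) = lim C_{T,n}(y,z)^{1/n}`; Proposition 7 and Corollary 8 treat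
ONE weighted wall).  E. J. Janse van Rensburg, E. Orlandini, A. L. Owczarek, A. Rechnitzer, S. G. Whittington, J. Phys. A 38 (2005)
L823–L828 / JvROW 2006 (self-avoiding walks in a slab with TWO attractive walls; = BBdGDCG's [16]; not held).  I. G. Enting, I. Jensen,
LNP 775 (2009) §7.4.2, Fig. 7.10 (brickwork form of the honeycomb lattice).  N. Madras, G. Slade, *The Self-Avoiding Walk* (1993)
§1.2 (concatenation), §8.2 (walks in strips, (8.2.1)–(8.2.3)).

## What is proved (namespace `…SAW.HexBW`)

In `S_1` BOTH weighted vertex classes are the sites of ODD abscissa: row `0` / odd `x` (bottom, dangling bond down) and row `1` / odd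
`x` (top: `x + 1` even, dangling bond up); the vertical bonds inside the strip sit at the EVEN columns.  A **switch walk** starts at the
weighted site `(1,0)` and runs to the right through units: the PLAIN unit `(x,r) → (x+1,r) → (x+2,r)` (two steps) and the SWITCH unit
`(x,r) → (x+1,r) → (x+1,1−r) → (x+2,1−r)` (three steps, the vertical bond at the even column `x+1`); every unit ends at a weighted
site.  A word with `n` units of which `k` are switches is a self-avoiding walk of `S_1` of length `2n + k` with exactly `n + 1` weighted
vertices, and distinct words give distinct translation classes:

* `HexBW.swWalk` / `HexBW.swLen` (the walk and its length for a switch set `s ⊆ {0,…,n−1}`), `swWalk_mem_saws`, `isBW_swWalk`,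
  `swPair_mem_stripPairs`, `bottomVisits₀_add_topVisits₀_swWalk` (`bc + tc = n + 1`), `swWalk_injective`;
* **`choose_mul_pow_le_stripZ₂_one : C(n,k)·y^{n+1} ≤ C_{1,2n+k}(y,y)`** (`y ≥ 1`);
* along `N = j(2m+1)` with one switch per `m` units (`C(jm,j) ≥ m^j`, the tree's `Zd.pow_le_choose_mul`):
  **`rpow_le_stripMuY₂_one_self : (m·y^m)^{1/(2m+1)} ≤ μ_1(y,y)`** and `mul_pow_le_stripMuY₂_one_self_pow : m·y^m ≤ μ_1(y,y)^{2m+1}`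
  for every `m ≥ 1`, `y ≥ 1`;
* hence **`sqrt_lt_stripMuY₂_one_self : √y < μ_1(y,y)`** for every `y ≥ 1` (take `m > √y`): with two attractive walls the width-one
  strip beats the zig-zag rate `√y` STRICTLY — by switching rows at a small density the walk gains entropy at bounded cost
  (the optimum `m ≈ e√y` gives `μ_1(y,y) ≳ √y·e^{1/(2e√y)} ≈ √y + 0.18`).

This is input (B) of the lane's scoped theorem «two attractive walls, width one»: `μ_1(y,y) > μ(y)` for large `y` (with (A) the sharp
half-plane window `μ(y)² ≤ y + 972/y` of `HexSAWSurfaceSqrtSharpRec.lean`, HOME).  Label (author's proposal): LANE LEMMA, NEW-IN-WRITING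
(modest, S) for honeycomb strips; elementary.  Not in print: BBdGDCG14 treat one weighted wall (`μ_T(1,y)`), JvROW05/06 the `ℤ³` slab
numerically/rigorously without explicit rates.
-/

noncomputable section

open Finset Filter Topology Literature.Probability.LatticeModels Literature.Probability.Percolation SimpleGraph

namespace Literature.Probability.RandomPlanarGeometry.SAW.HexBW

-- Membership in `Zd.saws 2 n` / `saws n` is only ever used through `Zd.mem_saws` (never unfolded: for a numeral `n` the
-- definitional unfolding evaluates the finset).
attribute [local irreducible] Zd.saws saws

variable {y : ℝ}

/-- Two-coordinate extensionality for sites of `ℤ²` (local twin). [cite: MadrasSlade1993, §1.1] -/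
private theorem site_ext₁ {x z : Site 2} (h0 : x 0 = z 0) (h1 : x 1 = z 1) : x = z :=
  funext fun i => by fin_cases i <;> assumption

/-! ### The two units -/

/-- Abscissa offset of a unit at time `i`: plain `0,1,2,2,…`; switch `0,1,1,2,2,…`. [cite: EntingJensen2009, §7.4.2, Fig. 7.10] -/
def uX : Bool → ℕ → ℤ
  | false, i => if i = 0 then 0 else if i = 1 then 1 else 2
  | true, i => if i = 0 then 0 else if i = 1 then 1 else if i = 2 then 1 else 2

/-- Ordinate offset of a unit started on row `r` at time `i`: plain `0`; switch `0,0,1−2r,1−2r,…`. [cite: EntingJensen2009, §7.4.2, Fig. 7.10] -/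
def uY (r : ℤ) : Bool → ℕ → ℤ
  | false, _ => 0
  | true, i => if i ≤ 1 then 0 else 1 - 2 * r

/-- Length of a unit: plain `2`, switch `3`. [cite: EntingJensen2009, §7.4.2, Fig. 7.10] -/
def uLen : Bool → ℕ
  | false => 2
  | true => 3

/-- The unit walk from the origin (frozen after its length). [cite: EntingJensen2009, §7.4.2, Fig. 7.10] -/
def uWalk (r : ℤ) (b : Bool) (i : ℕ) : Site 2 := ![uX b i, uY r b i]

/-- Abscissa of the unit walk. [cite: EntingJensen2009, §7.4.2, Fig. 7.10] -/
@[simp] theorem uWalk_apply_zero (r : ℤ) (b : Bool) (i : ℕ) : uWalk r b i 0 = uX b i := rfl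

/-- Ordinate of the unit walk. [cite: EntingJensen2009, §7.4.2, Fig. 7.10] -/
@[simp] theorem uWalk_apply_one (r : ℤ) (b : Bool) (i : ℕ) : uWalk r b i 1 = uY r b i := rfl

/-- `2 ≤ uLen b ≤ 3`. [cite: EntingJensen2009, §7.4.2, Fig. 7.10] -/
theorem uLen_bounds (b : Bool) : 2 ≤ uLen b ∧ uLen b ≤ 3 := by cases b <;> simp [uLen]

/-- The unit starts at the origin. [cite: EntingJensen2009, §7.4.2, Fig. 7.10] -/
theorem uWalk_zero (r : ℤ) (b : Bool) : uWalk r b 0 = 0 :=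
  site_ext₁ (by cases b <;> simp [uX]) (by cases b <;> simp [uY])

/-- `0 ≤ uX ≤ 2`. [cite: EntingJensen2009, §7.4.2, Fig. 7.10] -/
theorem uX_bounds (b : Bool) (i : ℕ) : 0 ≤ uX b i ∧ uX b i ≤ 2 := by
  cases b <;> simp only [uX] <;> split_ifs <;> omega

/-- `1 ≤ uX` from time `1` on. [cite: EntingJensen2009, §7.4.2, Fig. 7.10] -/
theorem one_le_uX (b : Bool) {i : ℕ} (hi : 1 ≤ i) : 1 ≤ uX b i := by
  cases b <;> simp only [uX] <;> split_ifs <;> omega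

/-- The unit ends two columns to the right. [cite: EntingJensen2009, §7.4.2, Fig. 7.10] -/
theorem uX_uLen (b : Bool) : uX b (uLen b) = 2 := by cases b <;> simp [uX, uLen]

/-- The unit ends on row `r` (plain) or `1 − r` (switch): ordinate offset `0` or `1 − 2r`. [cite: EntingJensen2009, §7.4.2, Fig. 7.10] -/
theorem uY_uLen (r : ℤ) (b : Bool) : r + uY r b (uLen b) = if b then 1 - r else r := by
  cases b
  · simp [uY]
  · have h3 : ¬ (3 : ℕ) ≤ 1 := by omega
    simp only [uY, uLen, h3, if_false, if_true]
    ring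

/-- At time `2` the abscissa offset tells the unit apart: `2` for plain, `1` for switch. [cite: EntingJensen2009, §7.4.2, Fig. 7.10] -/
theorem uX_two (b : Bool) : uX b 2 = if b then 1 else 2 := by cases b <;> simp [uX]

/-- The unit is frozen after its length. [cite: MadrasSlade1993, §1.1] -/
theorem uWalk_of_le (r : ℤ) (b : Bool) {i : ℕ} (hi : uLen b ≤ i) : uWalk r b i = uWalk r b (uLen b) := by
  refine site_ext₁ ?_ ?_
  · rw [uWalk_apply_zero, uWalk_apply_zero, uX_uLen]
    cases b
    · simp only [uLen] at hi
      simp only [uX, if_neg (show i ≠ 0 by omega), if_neg (show i ≠ 1 by omega)]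
    · simp only [uLen] at hi
      simp only [uX, if_neg (show i ≠ 0 by omega), if_neg (show i ≠ 1 by omega), if_neg (show i ≠ 2 by omega)]
  · rw [uWalk_apply_one, uWalk_apply_one]
    cases b
    · simp only [uY]
    · simp only [uLen] at hi
      simp only [uY, uLen, if_neg (show ¬ i ≤ 1 by omega), if_neg (show ¬ (3 : ℕ) ≤ 1 by omega)]

/-- The rows visited by a unit started on row `r ∈ {0,1}` are `0` or `1`. [cite: EntingJensen2009, §7.4.2, Fig. 7.10] -/
theorem uY_row {r : ℤ} (hr : r = 0 ∨ r = 1) (b : Bool) (i : ℕ) : 0 ≤ r + uY r b i ∧ r + uY r b i ≤ 1 := by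
  cases b
  · simp only [uY, add_zero]; omega
  · simp only [uY]; split_ifs <;> omega

/-- **The unit placed at a weighted site steps along brick-wall bonds**: start abscissa odd, start row `r ∈ {0,1}`; the switch's vertical
bond is at the even column. [cite: EntingJensen2009, §7.4.2, Fig. 7.10 (vertical bonds {(x,y),(x,y+1)} with x+y even)] -/
theorem uWalk_adj {a : Site 2} {r : ℤ} (ha0 : a 0 % 2 = 1) (ha1 : a 1 = r) (hr : r = 0 ∨ r = 1) (b : Bool) {i : ℕ}
    (hi : i < uLen b) : brickWallGraph.Adj (a + uWalk r b i) (a + uWalk r b (i + 1)) := by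
  rw [brickWallGraph_adj_coord]
  simp only [Pi.add_apply, uWalk_apply_zero, uWalk_apply_one]
  cases b <;> simp only [uLen] at hi
  · interval_cases i
    · simp [uX, uY]
    · simp [uX, uY]; omega
  · interval_cases i <;> simp [uX, uY] <;> omega

/-- The unit is injective on `{0,…,uLen b}`. [cite: MadrasSlade1993, §1.1] -/
theorem uWalk_injOn (r : ℤ) (b : Bool) : Set.InjOn (uWalk r b) {i | i ≤ uLen b} := by
  intro i hi j hj h
  simp only [Set.mem_setOf_eq] at hi hj
  have h0 := congrFun h 0
  have h1 := congrFun h 1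
  simp only [uWalk_apply_zero, uWalk_apply_one] at h0 h1
  cases b <;> simp only [uLen] at hi hj <;> simp only [uX, uY] at h0 h1 <;> split_ifs at h0 h1 <;> omega

/-- The unit is a self-avoiding walk of `ℤ²` of length `uLen b` (for `r ∈ {0,1}`; adjacency read off the copy placed at `(1,r)`).
[cite: MadrasSlade1993, §1.1] -/
theorem uWalk_mem_saws {r : ℤ} (hr : r = 0 ∨ r = 1) (b : Bool) : uWalk r b ∈ Zd.saws 2 (uLen b) := by
  rw [Zd.mem_saws]
  refine ⟨uWalk_zero r b, fun i hi => uWalk_of_le r b hi, fun i hi => ?_, uWalk_injOn r b⟩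
  set a : Site 2 := ![1, r] with ha
  have h := zd_adj_of_adj (uWalk_adj (a := a) (by simp [ha]) (by simp [ha]) hr b hi)
  rwa [add_comm a, add_comm a, Zd.zdGraph_adj_add_right] at h

/-- Odd-column sites of a placed unit at positive times: exactly one (its endpoint). [cite: BeatonBousquetMelouDeGierDuminilCopinGuttmann2014, §3.2 (arXiv v5 p. 10: bc(ω), tc(ω))] -/
theorem sum_uWalk_odd {a : Site 2} (ha0 : a 0 % 2 = 1) (r : ℤ) (b : Bool) :
    ∑ j ∈ range (uLen b), (if (a + uWalk r b (j + 1)) 0 % 2 = 1 then 1 else 0) = 1 := by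
  have h1 : (a 0 + 1) % 2 ≠ 1 := by omega
  have h2 : (a 0 + 2) % 2 = 1 := by omega
  cases b <;> simp only [uLen, Finset.sum_range_succ, Finset.sum_range_zero, Pi.add_apply, uWalk_apply_zero, uX] <;>
    simp [h1, h2]

/-! ### Switch walks -/

/-- The switch indicator of unit `i`. [cite: BeatonBousquetMelouDeGierDuminilCopinGuttmann2014, §3.2 (arXiv v5 p. 10)] -/
def sw (s : Finset ℕ) (i : ℕ) : Bool := decide (i ∈ s)

/-- **The switch walk** of the switch set `s` with `n` units, started on row `r` at unit index `i₀` (from the origin, frozen at the end):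
unit `i₀`, then the walk of the remaining `n − 1` units from the row reached. [cite: MadrasSlade1993, §1.2 (concatenation); EntingJensen2009, §7.4.2, Fig. 7.10] -/
def swWalk (s : Finset ℕ) : ℕ → ℤ → ℕ → (ℕ → Site 2)
  | 0, _, _ => fun _ => 0
  | n + 1, r, i₀ => Zd.concatWalk (uLen (sw s i₀)) (uWalk r (sw s i₀))
      (swWalk s n (if sw s i₀ then 1 - r else r) (i₀ + 1))

/-- The length of the switch walk: `Σ_{i₀ ≤ i < i₀+n} (2 + [i ∈ s])`. [cite: MadrasSlade1993, §1.2] -/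
def swLen (s : Finset ℕ) (i₀ n : ℕ) : ℕ := ∑ i ∈ range n, uLen (sw s (i₀ + i))

/-- Unfolding the length. [cite: MadrasSlade1993, §1.2] -/
theorem swLen_succ (s : Finset ℕ) (i₀ n : ℕ) : swLen s i₀ (n + 1) = uLen (sw s i₀) + swLen s (i₀ + 1) n := by
  rw [swLen, swLen, Finset.sum_range_succ', add_comm, Nat.add_zero]
  congr 1
  exact Finset.sum_congr rfl fun i _ => by rw [show i₀ + (i + 1) = i₀ + 1 + i by omega]

/-- `swLen s i₀ 0 = 0`. [cite: MadrasSlade1993, §1.2] -/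
@[simp] theorem swLen_zero (s : Finset ℕ) (i₀ : ℕ) : swLen s i₀ 0 = 0 := by simp [swLen]

/-- **Length = `2n + #s`** for a switch set `s ⊆ {0,…,n−1}`. [cite: MadrasSlade1993, §8.2] -/
theorem swLen_eq (n : ℕ) {s : Finset ℕ} (hs : s ⊆ range n) : swLen s 0 n = 2 * n + #s := by
  have e : ∀ i, uLen (sw s (0 + i)) = 2 + (if i ∈ s then 1 else 0) := by
    intro i
    rw [Nat.zero_add, sw]
    by_cases h : i ∈ s <;> simp [h, uLen]
  rw [swLen, Finset.sum_congr rfl fun i _ => e i, Finset.sum_add_distrib, Finset.sum_const, Finset.card_range,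
    smul_eq_mul, mul_comm, Finset.sum_ite_mem, Finset.inter_eq_right.2 hs, Finset.sum_const, smul_eq_mul, mul_one]

/-- Unfolding the walk. [cite: MadrasSlade1993, §1.2] -/
theorem swWalk_succ (s : Finset ℕ) (n : ℕ) (r : ℤ) (i₀ : ℕ) :
    swWalk s (n + 1) r i₀ = Zd.concatWalk (uLen (sw s i₀)) (uWalk r (sw s i₀))
      (swWalk s n (if sw s i₀ then 1 - r else r) (i₀ + 1)) := rfl

/-- The switch walk starts at the origin. [cite: MadrasSlade1993, §1.1] -/
theorem swWalk_zero (s : Finset ℕ) (n : ℕ) (r : ℤ) (i₀ : ℕ) : swWalk s n r i₀ 0 = 0 := by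
  cases n with
  | zero => rfl
  | succ n => rw [swWalk_succ, concat_of_le (Nat.zero_le _), uWalk_zero]

/-- The abscissa is non-negative. [cite: MadrasSlade1993, §8.2] -/
theorem swWalk_apply_zero_nonneg (s : Finset ℕ) (n : ℕ) (r : ℤ) (i₀ i : ℕ) : 0 ≤ swWalk s n r i₀ i 0 := by
  induction n generalizing r i₀ i with
  | zero => simp [swWalk]
  | succ n ih =>
    rw [swWalk_succ]
    by_cases h : i ≤ uLen (sw s i₀)
    · rw [concat_of_le h, uWalk_apply_zero]; exact (uX_bounds _ _).1
    · rw [concat_of_lt (Nat.not_le.1 h), Pi.add_apply, uWalk_apply_zero]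
      exact add_nonneg (uX_bounds _ _).1 (ih _ _ _)

/-- The abscissa is `≥ 1` at every positive time up to the length. [cite: MadrasSlade1993, §8.2] -/
theorem one_le_swWalk_apply_zero (s : Finset ℕ) (n : ℕ) (r : ℤ) (i₀ : ℕ) {i : ℕ} (hi : 1 ≤ i) (hin : i ≤ swLen s i₀ n) :
    1 ≤ swWalk s n r i₀ i 0 := by
  cases n with
  | zero => simp at hin; omega
  | succ n =>
    rw [swWalk_succ]
    by_cases h : i ≤ uLen (sw s i₀)
    · rw [concat_of_le h, uWalk_apply_zero]; exact one_le_uX _ hi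
    · rw [concat_of_lt (Nat.not_le.1 h), Pi.add_apply, uWalk_apply_zero, uX_uLen]
      have := swWalk_apply_zero_nonneg s n (if sw s i₀ then 1 - r else r) (i₀ + 1) (i - uLen (sw s i₀))
      linarith

/-- **Switch walks are self-avoiding walks of `ℤ²`** (the pieces are separated by their abscissae). [cite: MadrasSlade1993, §1.2 (concatenation of walks)] -/
theorem swWalk_mem_saws (s : Finset ℕ) (n : ℕ) {r : ℤ} (hr : r = 0 ∨ r = 1) (i₀ : ℕ) :
    swWalk s n r i₀ ∈ Zd.saws 2 (swLen s i₀ n) := by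
  induction n generalizing r i₀ with
  | zero =>
    rw [swLen_zero, Zd.mem_saws]
    exact ⟨rfl, fun _ _ => rfl, fun i hi => absurd hi (Nat.not_lt_zero _), fun i hi j hj _ => by
      simp only [Set.mem_setOf_eq, Nat.le_zero] at hi hj; rw [hi, hj]⟩
  | succ n ih =>
    rw [swLen_succ, swWalk_succ]
    have hr' : (if sw s i₀ then 1 - r else r) = 0 ∨ (if sw s i₀ then 1 - r else r) = 1 := by
      split_ifs <;> omega
    refine Zd.concatWalk_mem_saws (uWalk_mem_saws hr _) (ih hr' (i₀ + 1)) fun i hi j hj1 hj2 heq => ?_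
    have h0 := congrFun heq 0
    simp only [Pi.add_apply, uWalk_apply_zero, uX_uLen] at h0
    have h1 := (uX_bounds (sw s i₀) i).2
    have h2 := one_le_swWalk_apply_zero s n (if sw s i₀ then 1 - r else r) (i₀ + 1) hj1 hj2
    omega

/-- The rows of a switch walk started on row `r ∈ {0,1}` are `0` or `1`. [cite: MadrasSlade1993, §8.2, eq. (8.2.1)] -/
theorem swWalk_row (s : Finset ℕ) (n : ℕ) {r : ℤ} (hr : r = 0 ∨ r = 1) (i₀ i : ℕ) :
    0 ≤ r + swWalk s n r i₀ i 1 ∧ r + swWalk s n r i₀ i 1 ≤ 1 := by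
  induction n generalizing r i₀ i with
  | zero => simp [swWalk]; omega
  | succ n ih =>
    rw [swWalk_succ]
    by_cases h : i ≤ uLen (sw s i₀)
    · rw [concat_of_le h, uWalk_apply_one]; exact uY_row hr _ _
    · rw [concat_of_lt (Nat.not_le.1 h), Pi.add_apply, uWalk_apply_one, ← add_assoc, uY_uLen]
      exact ih (by split_ifs <;> omega) _ _

/-- Placing a concatenation = concatenating the placed first piece with the same second piece. [cite: MadrasSlade1993, §1.2] -/
private theorem add_concatWalk (a : Site 2) (m : ℕ) (ω υ : ℕ → Site 2) :
    (fun i => a + Zd.concatWalk m ω υ i) = Zd.concatWalk m (fun i => a + ω i) υ := by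
  funext i
  by_cases h : i ≤ m
  · rw [concat_of_le h, concat_of_le h]
  · rw [concat_of_lt (Nat.not_le.1 h), concat_of_lt (Nat.not_le.1 h), add_assoc]

/-- **The placed switch walk steps along brick-wall bonds** (start abscissa odd, start row `r ∈ {0,1}`).
[cite: EntingJensen2009, §7.4.2, Fig. 7.10; MadrasSlade1993, §8.2] -/
theorem isBW_swWalk (s : Finset ℕ) (n : ℕ) {r : ℤ} (hr : r = 0 ∨ r = 1) (i₀ : ℕ) {a : Site 2} (ha0 : a 0 % 2 = 1)
    (ha1 : a 1 = r) : IsBW (swLen s i₀ n) (fun i => a + swWalk s n r i₀ i) := by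
  induction n generalizing r i₀ a with
  | zero => intro i hi; simp at hi
  | succ n ih =>
    rw [swLen_succ, swWalk_succ, add_concatWalk]
    refine isBW_concatWalk (fun i hi => uWalk_adj ha0 ha1 hr _ hi) (swWalk_zero _ _ _ _) fun j hj => ?_
    have hr' : (if sw s i₀ then 1 - r else r) = 0 ∨ (if sw s i₀ then 1 - r else r) = 1 := by
      split_ifs <;> omega
    have hb0 : (a + uWalk r (sw s i₀) (uLen (sw s i₀))) 0 % 2 = 1 := by
      rw [Pi.add_apply, uWalk_apply_zero, uX_uLen]; omega
    have hb1 : (a + uWalk r (sw s i₀) (uLen (sw s i₀))) 1 = (if sw s i₀ then 1 - r else r) := by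
      rw [Pi.add_apply, uWalk_apply_one, ha1, uY_uLen]
    have h := ih hr' (i₀ + 1) hb0 hb1 j hj
    simpa only [add_assoc] using h

/-! ### The switch walks as members of `S_N(S_1)` -/

/-- The weighted starting site `(1,0)` of the strip `S_1`. [cite: MadrasSlade1993, §8.2, eq. (8.2.1)] -/
def swStart : Site 2 := ![1, 0]

/-- Coordinates of the starting site. [cite: MadrasSlade1993, §8.2, eq. (8.2.1)] -/
@[simp] theorem swStart_apply_zero : swStart 0 = 1 := rfl

/-- Coordinates of the starting site. [cite: MadrasSlade1993, §8.2, eq. (8.2.1)] -/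
@[simp] theorem swStart_apply_one : swStart 1 = 0 := rfl

/-- The translation class of the switch walk of `s` with `n` units. [cite: MadrasSlade1993, §8.2] -/
def swPair (n : ℕ) (s : Finset ℕ) : Site 2 × (ℕ → Site 2) := (swStart, swWalk s n 0 0)

/-- **Switch walks are walks of `S_N(S_1)`, `N = swLen s 0 n`.** [cite: MadrasSlade1993, §8.2; BeatonBousquetMelouDeGierDuminilCopinGuttmann2014, §3.2 (arXiv v5 p. 10: walks in the strip of width T)] -/
theorem swPair_mem_stripPairs (n : ℕ) (s : Finset ℕ) : swPair n s ∈ stripPairs 1 (swLen s 0 n) := by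
  rw [mem_stripPairs, swPair]
  refine ⟨mem_stripStarts.2 ⟨⟨by simp, by simp⟩, by simp, by simp⟩,
    swWalk_mem_saws s n (Or.inl rfl) 0, isBW_swWalk s n (Or.inl rfl) 0 (by simp) (by simp), fun m _ => ?_⟩
  have h := swWalk_row s n (r := 0) (Or.inl rfl) 0 m
  simp only [zero_add] at h
  exact ⟨by simp [h.1], by simpa using h.2⟩

/-- Odd-column visits at the positive times `1,…,N` of a placed walk. [cite: BeatonBousquetMelouDeGierDuminilCopinGuttmann2014, §3.2 (arXiv v5 p. 10: bc(ω), tc(ω))] -/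
def oddPos (a : Site 2) (υ : ℕ → Site 2) (N : ℕ) : ℕ := ∑ j ∈ range N, if (a + υ (j + 1)) 0 % 2 = 1 then 1 else 0

/-- **Each unit adds exactly one odd-column (= weighted) site**: `oddPos = n`. [cite: BeatonBousquetMelouDeGierDuminilCopinGuttmann2014, §3.2 (arXiv v5 p. 10)] -/
theorem oddPos_swWalk (s : Finset ℕ) (n : ℕ) (r : ℤ) (i₀ : ℕ) {a : Site 2} (ha0 : a 0 % 2 = 1) :
    oddPos a (swWalk s n r i₀) (swLen s i₀ n) = n := by
  induction n generalizing r i₀ a with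
  | zero => simp [oddPos]
  | succ n ih =>
    rw [oddPos, swLen_succ, Finset.sum_range_add, swWalk_succ]
    have h1 : ∑ j ∈ range (uLen (sw s i₀)), (if (a + Zd.concatWalk (uLen (sw s i₀)) (uWalk r (sw s i₀))
        (swWalk s n (if sw s i₀ then 1 - r else r) (i₀ + 1)) (j + 1)) 0 % 2 = 1 then 1 else 0) = 1 := by
      refine Eq.trans (Finset.sum_congr rfl fun j hj => ?_) (sum_uWalk_odd ha0 r (sw s i₀))
      rw [concat_of_le (Nat.succ_le_of_lt (Finset.mem_range.1 hj))]
    have hb0 : (a + uWalk r (sw s i₀) (uLen (sw s i₀))) 0 % 2 = 1 := by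
      rw [Pi.add_apply, uWalk_apply_zero, uX_uLen]; omega
    have h2 := ih (if sw s i₀ then 1 - r else r) (i₀ + 1) hb0
    rw [oddPos] at h2
    rw [h1, add_comm (1 : ℕ)]
    congr 1
    refine Eq.trans (Finset.sum_congr rfl fun j _ => ?_) h2
    rw [show uLen (sw s i₀) + j + 1 = uLen (sw s i₀) + (j + 1) by omega, concat_add (swWalk_zero _ _ _ _), add_assoc]

/-- In a strip of width one, bottom + top visit counts = the number of odd-column sites visited. [cite: BeatonBousquetMelouDeGierDuminilCopinGuttmann2014, §3.2 (arXiv v5 p. 10: bc(ω) + tc(ω))] -/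
theorem bottomVisits₀_add_topVisits₀_eq (a : Site 2) (υ : ℕ → Site 2) (N : ℕ)
    (hrow : ∀ m ≤ N, 0 ≤ (a + υ m) 1 ∧ (a + υ m) 1 ≤ 1) :
    bottomVisits₀ a υ N + topVisits₀ 1 a υ N =
      (if (a + υ 0) 0 % 2 = 1 then 1 else 0) + oddPos a υ N := by
  have hpt : ∀ m ∈ range (N + 1), ((if (a + υ m) 1 = 0 ∧ (a + υ m) 0 % 2 = 1 then 1 else 0) +
      (if (a + υ m) 1 = ((1 : ℕ) : ℤ) ∧ ((a + υ m) 0 + ((1 : ℕ) : ℤ)) % 2 = 0 then 1 else 0)) =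
      (if (a + υ m) 0 % 2 = 1 then 1 else 0) := by
    intro m hm
    have h := hrow m (Nat.lt_succ_iff.1 (Finset.mem_range.1 hm))
    push_cast
    split_ifs <;> omega
  unfold bottomVisits₀ topVisits₀ oddPos
  calc (∑ m ∈ range (N + 1), (if (a + υ m) 1 = 0 ∧ (a + υ m) 0 % 2 = 1 then 1 else 0)) +
        ∑ m ∈ range (N + 1), (if (a + υ m) 1 = ((1 : ℕ) : ℤ) ∧ ((a + υ m) 0 + ((1 : ℕ) : ℤ)) % 2 = 0 then 1 else 0)
      = ∑ m ∈ range (N + 1), ((if (a + υ m) 1 = 0 ∧ (a + υ m) 0 % 2 = 1 then 1 else 0) +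
          (if (a + υ m) 1 = ((1 : ℕ) : ℤ) ∧ ((a + υ m) 0 + ((1 : ℕ) : ℤ)) % 2 = 0 then 1 else 0)) :=
        Finset.sum_add_distrib.symm
    _ = ∑ m ∈ range (N + 1), (if (a + υ m) 0 % 2 = 1 then 1 else 0) := Finset.sum_congr rfl hpt
    _ = (if (a + υ 0) 0 % 2 = 1 then 1 else 0) + ∑ j ∈ range N, (if (a + υ (j + 1)) 0 % 2 = 1 then 1 else 0) := by
        rw [Finset.sum_range_succ', add_comm]

/-- **The switch walk of `n` units has exactly `n + 1` weighted vertices**: `bc + tc = n + 1`. [cite: BeatonBousquetMelouDeGierDuminilCopinGuttmann2014, §3.2 (arXiv v5 p. 10: y^{bc(ω)} z^{tc(ω)})] -/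
theorem bottomVisits₀_add_topVisits₀_swWalk (n : ℕ) (s : Finset ℕ) :
    bottomVisits₀ swStart (swWalk s n 0 0) (swLen s 0 n) + topVisits₀ 1 swStart (swWalk s n 0 0) (swLen s 0 n) = n + 1 := by
  rw [bottomVisits₀_add_topVisits₀_eq _ _ _ fun m _ => by
      have h := swWalk_row s n (r := 0) (Or.inl rfl) 0 m; simp only [zero_add] at h; simpa using h,
    oddPos_swWalk s n 0 0 (by simp), swWalk_zero]
  simp [add_comm]

/-- The tail of a switch walk is read off the walk: `W'(i) = W(i + m) − U(m)`. [cite: MadrasSlade1993, §1.2] -/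
private theorem swWalk_tail (s : Finset ℕ) (n : ℕ) (r : ℤ) (i₀ i : ℕ) :
    swWalk s n (if sw s i₀ then 1 - r else r) (i₀ + 1) i =
      swWalk s (n + 1) r i₀ (uLen (sw s i₀) + i) - uWalk r (sw s i₀) (uLen (sw s i₀)) := by
  rw [swWalk_succ, concat_add (swWalk_zero _ _ _ _), add_sub_cancel_left]

/-- **Distinct switch sets give distinct walks** (the unit `i₀` is read off the abscissa at time `2`, then induct on the tail).
[cite: MadrasSlade1993, §8.2] -/
theorem swWalk_decode (n : ℕ) {s s' : Finset ℕ} {r : ℤ} {i₀ : ℕ} (h : swWalk s n r i₀ = swWalk s' n r i₀) :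
    ∀ i, i₀ ≤ i → i < i₀ + n → (i ∈ s ↔ i ∈ s') := by
  induction n generalizing r i₀ with
  | zero => intro i h1 h2; omega
  | succ n ih =>
    have hb : sw s i₀ = sw s' i₀ := by
      have h2 := congrFun (congrFun h 2) 0
      rw [swWalk_succ, swWalk_succ, concat_of_le (uLen_bounds _).1, concat_of_le (uLen_bounds _).1, uWalk_apply_zero,
        uWalk_apply_zero, uX_two, uX_two] at h2
      revert h2
      cases sw s i₀ <;> cases sw s' i₀ <;> simp
    have htail : swWalk s n (if sw s i₀ then 1 - r else r) (i₀ + 1) = swWalk s' n (if sw s i₀ then 1 - r else r) (i₀ + 1) := by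
      funext i
      have t1 := swWalk_tail s n r i₀ i
      have t2 := swWalk_tail s' n r i₀ i
      rw [← hb] at t2
      rw [t1, t2, h]
    intro i h1 h2
    rcases Nat.eq_or_lt_of_le h1 with h3 | h3
    · subst h3
      have : (sw s i₀ = true) ↔ (sw s' i₀ = true) := by rw [hb]
      simpa [sw] using this
    · exact ih htail i (by omega) (by omega)

/-- **`swPair n` is injective on the switch sets `s ⊆ {0,…,n−1}`.** [cite: MadrasSlade1993, §8.2] -/
theorem swPair_injOn (n k : ℕ) : Set.InjOn (swPair n) ↑((range n).powersetCard k) := by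
  intro s hs s' hs' h
  have hs1 := (Finset.mem_powersetCard.1 (Finset.mem_coe.1 hs)).1
  have hs1' := (Finset.mem_powersetCard.1 (Finset.mem_coe.1 hs')).1
  have hw : swWalk s n 0 0 = swWalk s' n 0 0 := congrArg Prod.snd h
  ext i
  by_cases hi : i < n
  · exact swWalk_decode n hw i (Nat.zero_le _) (by omega)
  · constructor
    · intro h'; exact absurd (Finset.mem_range.1 (hs1 h')) hi
    · intro h'; exact absurd (Finset.mem_range.1 (hs1' h')) hi

/-! ### The finite lower bound and the rate -/

/-- **`C(n,k)·y^{n+1} ≤ C_{1,2n+k}(y,y)`** (`y ≥ 1`): the switch walks with `k` switches among `n` units are `C(n,k)` distinct walks of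
`S_{2n+k}(S_1)`, each of weight `y^{n+1}`. [cite: BeatonBousquetMelouDeGierDuminilCopinGuttmann2014, §3.2 (arXiv v5 p. 10: C_{T,k}(y,z)); MadrasSlade1993, §8.2] -/
theorem choose_mul_pow_le_stripZ₂_one (hy : 1 ≤ y) (n k : ℕ) :
    ((n.choose k : ℕ) : ℝ) * y ^ (n + 1) ≤ stripZ₂ 1 (2 * n + k) y y := by
  classical
  have hy0 : 0 < y := by linarith
  set S := (range n).powersetCard k with hS
  have hmem : ∀ s ∈ S, swPair n s ∈ stripPairs 1 (2 * n + k) := by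
    intro s hs
    obtain ⟨hsub, hcard⟩ := Finset.mem_powersetCard.1 hs
    have h := swPair_mem_stripPairs n s
    rwa [swLen_eq n hsub, hcard] at h
  have hw : ∀ s ∈ S, y ^ bottomVisits₀ (swPair n s).1 (swPair n s).2 (2 * n + k) *
      y ^ topVisits₀ 1 (swPair n s).1 (swPair n s).2 (2 * n + k) = y ^ (n + 1) := by
    intro s hs
    obtain ⟨hsub, hcard⟩ := Finset.mem_powersetCard.1 hs
    rw [← pow_add, swPair]
    simp only
    rw [← hcard, ← swLen_eq n hsub, bottomVisits₀_add_topVisits₀_swWalk]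
  calc ((n.choose k : ℕ) : ℝ) * y ^ (n + 1) = ∑ s ∈ S, y ^ (n + 1) := by
        rw [Finset.sum_const, hS, Finset.card_powersetCard, Finset.card_range, nsmul_eq_mul]
    _ = ∑ s ∈ S, y ^ bottomVisits₀ (swPair n s).1 (swPair n s).2 (2 * n + k) *
          y ^ topVisits₀ 1 (swPair n s).1 (swPair n s).2 (2 * n + k) := Finset.sum_congr rfl fun s hs => (hw s hs).symm
    _ = ∑ p ∈ S.image (swPair n), y ^ bottomVisits₀ p.1 p.2 (2 * n + k) * y ^ topVisits₀ 1 p.1 p.2 (2 * n + k) := by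
        rw [Finset.sum_image fun s hs s' hs' h => swPair_injOn n k hs hs' h]
    _ ≤ stripZ₂ 1 (2 * n + k) y y := by
        rw [stripZ₂]
        refine Finset.sum_le_sum_of_subset_of_nonneg (fun p hp => ?_) fun p _ _ => by positivity
        obtain ⟨s, hs, rfl⟩ := Finset.mem_image.1 hp
        exact hmem s hs

/-- The finite bound along `N = j(2m+1)`: `(m·y^m)^j ≤ C_{1, j(2m+1)}(y,y)` (`y ≥ 1`). [cite: BeatonBousquetMelouDeGierDuminilCopinGuttmann2014, §3.2 (arXiv v5 p. 10); MadrasSlade1993, §8.2] -/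
theorem mul_pow_pow_le_stripZ₂_one (hy : 1 ≤ y) (m j : ℕ) :
    ((m : ℝ) * y ^ (m : ℕ)) ^ j ≤ stripZ₂ 1 (j * (2 * m + 1)) y y := by
  have hy0 : 0 ≤ y := by linarith
  have h := choose_mul_pow_le_stripZ₂_one hy (j * m) j
  rw [show 2 * (j * m) + j = j * (2 * m + 1) by ring] at h
  have hc : ((m : ℝ) ^ j) ≤ ((j * m).choose j : ℕ) := by
    rw [mul_comm j m]; exact_mod_cast Zd.pow_le_choose_mul m j
  calc ((m : ℝ) * y ^ (m : ℕ)) ^ j = (m : ℝ) ^ j * y ^ (j * m) := by rw [mul_pow, ← pow_mul, mul_comm m j]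
    _ ≤ ((j * m).choose j : ℕ) * y ^ (j * m) := mul_le_mul_of_nonneg_right hc (by positivity)
    _ ≤ ((j * m).choose j : ℕ) * y ^ (j * m + 1) :=
        mul_le_mul_of_nonneg_left (pow_le_pow_right₀ hy (Nat.le_succ _)) (by positivity)
    _ ≤ stripZ₂ 1 (j * (2 * m + 1)) y y := h

/-- **`(m·y^m)^{1/(2m+1)} ≤ μ_1(y,y)`** for every `m ≥ 1`, `y ≥ 1`. [cite: BeatonBousquetMelouDeGierDuminilCopinGuttmann2014, Proposition 6 (arXiv v5 p. 10: μ_T(y,z) = lim C_{T,n}(y,z)^{1/n}); MadrasSlade1993, §8.2, (8.2.2)–(8.2.3)] -/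
theorem rpow_le_stripMuY₂_one_self (hy : 1 ≤ y) {m : ℕ} (hm : 1 ≤ m) :
    ((m : ℝ) * y ^ (m : ℕ)) ^ (1 / (2 * (m : ℝ) + 1)) ≤ stripMuY₂ 1 y y := by
  have hy0 : 0 < y := by linarith
  have hL := tendsto_stripZ₂_rpow 1 hy0 hy0
  have hφt : Tendsto (fun j : ℕ => (j + 1) * (2 * m + 1)) atTop atTop :=
    tendsto_atTop_mono (fun j => by show j ≤ (j + 1) * (2 * m + 1); nlinarith) tendsto_id
  have hL' := hL.comp hφt
  refine ge_of_tendsto' hL' fun j => ?_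
  simp only [Function.comp]
  have hc0 : (0 : ℝ) ≤ (m : ℝ) * y ^ (m : ℕ) := by positivity
  have hN : ((((j + 1) * (2 * m + 1) : ℕ) : ℝ)) = ((j : ℝ) + 1) * (2 * (m : ℝ) + 1) := by push_cast; ring
  have hpos : (0 : ℝ) < ((j : ℝ) + 1) * (2 * (m : ℝ) + 1) := by positivity
  have e : ((m : ℝ) * y ^ (m : ℕ)) ^ (1 / (2 * (m : ℝ) + 1)) =
      ((((m : ℝ) * y ^ (m : ℕ)) ^ (j + 1) : ℝ)) ^ (1 / ((((j + 1) * (2 * m + 1) : ℕ) : ℝ))) := by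
    rw [hN, ← Real.rpow_natCast ((m : ℝ) * y ^ (m : ℕ)) (j + 1), ← Real.rpow_mul hc0]
    congr 1
    push_cast
    field_simp
  rw [e]
  exact Real.rpow_le_rpow (by positivity) (mul_pow_pow_le_stripZ₂_one hy m (j + 1)) (by positivity)

/-- **`m·y^m ≤ μ_1(y,y)^{2m+1}`** for every `m ≥ 1`, `y ≥ 1`. [cite: BeatonBousquetMelouDeGierDuminilCopinGuttmann2014, Proposition 6 (arXiv v5 p. 10)] -/
theorem mul_pow_le_stripMuY₂_one_self_pow (hy : 1 ≤ y) {m : ℕ} (hm : 1 ≤ m) :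
    (m : ℝ) * y ^ (m : ℕ) ≤ stripMuY₂ 1 y y ^ (2 * m + 1) := by
  have hy0 : 0 < y := by linarith
  have hμ := (stripMuY₂_pos 1 hy0 hy0).le
  have hc0 : (0 : ℝ) ≤ (m : ℝ) * y ^ (m : ℕ) := by positivity
  have h := rpow_le_stripMuY₂_one_self hy hm
  have hpos : (0 : ℝ) < 2 * (m : ℝ) + 1 := by positivity
  have e : (m : ℝ) * y ^ (m : ℕ) = (((m : ℝ) * y ^ (m : ℕ)) ^ (1 / (2 * (m : ℝ) + 1))) ^ (2 * m + 1) := by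
    rw [← Real.rpow_natCast (((m : ℝ) * y ^ (m : ℕ)) ^ (1 / (2 * (m : ℝ) + 1))) (2 * m + 1), ← Real.rpow_mul hc0]
    push_cast
    rw [one_div_mul_cancel hpos.ne', Real.rpow_one]
  rw [e]
  exact pow_le_pow_left₀ (by positivity) h _

/-- **`√y < μ_1(y,y)` for every `y ≥ 1`**: two attractive walls at width one beat the zig-zag rate strictly (take `m > √y`:
`μ_1^{2m+1} ≥ m·y^m > √y·y^m = √y^{2m+1}`). [cite: BeatonBousquetMelouDeGierDuminilCopinGuttmann2014, §3.1, Proposition 5 (arXiv v5 p. 9: the zig-zag bound √y) and §3.2, Proposition 7 (one weighted wall)] -/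
theorem sqrt_lt_stripMuY₂_one_self (hy : 1 ≤ y) : Real.sqrt y < stripMuY₂ 1 y y := by
  have hy0 : 0 < y := by linarith
  have hμ := (stripMuY₂_pos 1 hy0 hy0).le
  set m : ℕ := ⌊y⌋₊ + 1 with hm
  have hm1 : 1 ≤ m := by omega
  have hmy : y < m := by rw [hm]; push_cast; exact Nat.lt_floor_add_one y
  have hsy : Real.sqrt y ≤ y := by
    rw [Real.sqrt_le_left (by linarith)]; nlinarith
  have hs0 : 0 ≤ Real.sqrt y := Real.sqrt_nonneg y
  have h := mul_pow_le_stripMuY₂_one_self_pow hy hm1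
  have hlt : Real.sqrt y ^ (2 * m + 1) < stripMuY₂ 1 y y ^ (2 * m + 1) := by
    have e : Real.sqrt y ^ (2 * m + 1) = Real.sqrt y * y ^ (m : ℕ) := by
      rw [pow_succ, pow_mul, Real.sq_sqrt hy0.le, mul_comm]
    rw [e]
    calc Real.sqrt y * y ^ (m : ℕ) < m * y ^ (m : ℕ) := mul_lt_mul_of_pos_right (lt_of_le_of_lt hsy hmy) (by positivity)
      _ ≤ stripMuY₂ 1 y y ^ (2 * m + 1) := h
  exact lt_of_pow_lt_pow_left₀ _ hμ hlt

end Literature.Probability.RandomPlanarGeometry.SAW.HexBW
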